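import Mathlib
import HarnessLib
import Summits.NavierStokesRegularity.NavierStokesRegularity.Theorems.UnthreadedRigidityDoorUnthreadedRigiditySpectralEdgeProportionalTwo
import Summits.NavierStokesRegularity.NavierStokesRegularity.Theorems.UnthreadedRigidityDoorUnthreadedRigidityVirialHornOrderTwoBracket
import Summits.NavierStokesRegularity.NavierStokesRegularity.Theorems.UnthreadedRigidityDoorUnthreadedRigiditySpectralEdgeGradSqJets

/-!
# Route `UnthreadedRigidityDoor`, wall item W2 `UnthreadedRigidity` (stmt-NavierStokesRegularity-27585) — LINE g13-2 «EDGE COERCIVITY»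
# (ns-idea-6 g13, `EdgeCoercive_sketch.lean` v1.3 §1b; DIRECTOR-NS #303 (A)): ★ the BRACKET–LAPLACIAN IDENTITY (I9)
# `BracketLaplacian l`, VERBATIM (the sketch-local `hessSq` unfolded), in EVERY degree `l`

Seat ns-es-p1 g9.  (I9): for every solid harmonic `Y` of degree `l`, `Δ₃{Y,|∇Y|²} = 4·{Y, |∇²Y|²}` pointwise on `ℝ³`
(`{f,g} = y·(∇f × ∇g)` = `pbr`, `{Y,|∇Y|²}` = `angForm`, `|∇²Y|² = Σᵢ‖D(∇Y)eᵢ‖²`).  The ideator certified it by exact lattice evaluation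
(`EDGE_certI9.py`, `l = 3..10`) and reduced it on paper to one cubic identity for trace-free symmetric 3-tensors; with the sketch's kernel-checked
glue (`edgeHalfLaplacian_of_bracket`) it yields the HALF-LAPLACIAN FORM of the edge coefficient `48𝔅_l = ½Δ₃Φ + (12l−2)Φ` for every `l`.

PROOF (frame-free jets, `…VirialHornAngularJets` + `…SpectralEdgeGradSqJets`).  With `g = ∇Y`, `H = D(∇Y)`, `T = D²(∇Y)`, `N = |∇Y|²`,
`G = ∇N = 2Hg`, `H_N = D(∇N)`, `T_N = D²(∇N)`: `Φ(z) = ⟪z × g, G⟫`, and twice differentiating along `v` (`dir2_rotInner`)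
`D²_vΦ = ⟪2v × Hv + y × Tvv, G⟫ + 2⟪v × g + y × Hv, H_N v⟫ + ⟪y × g, T_N v v⟫`.  Summing over `v = eᵢ`: `Σ eᵢ × Heᵢ = 0`, `Σ Teᵢeᵢ = 0`,
`Σ⟪eᵢ × g, H_N eᵢ⟫ = 0` (symmetric operators), `H_N eᵢ = 2(H(Heᵢ) + Teᵢ g)` with `Σ⟪y × Heᵢ, H(Heᵢ)⟫ = 0`, and `Σ T_N eᵢ eᵢ = 2∇|∇²Y|²`
(Bochner `Δ₃N = 2|∇²Y|²` differentiated); so `Δ₃Φ = 4Σᵢ⟪y × Heᵢ, Teᵢ g⟫ + 2⟪y × g, ∇|∇²Y|²⟫`, while `4{Y,|∇²Y|²} = 4⟪y × g, ∇|∇²Y|²⟫` and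
`⟪∇|∇²Y|², w⟫ = 2Σᵢ⟪T w eᵢ, Heᵢ⟫`.  (I9) is thus THE CUBIC IDENTITY `Σᵢ⟪y × Heᵢ, Teᵢ g⟫ = Σᵢ⟪T(y × g)eᵢ, Heᵢ⟫` (`cubic_identity`): for
`l ≠ 2`, Euler `T(y) = (l−2)H` (`third_apply_self`) makes it a polynomial identity in the seven free components of the trace-free symmetric `T`
(`trace_third`), closed by `ring`; for `l = 2`, `T = 0`.

HONEST LABEL: a pointwise polynomial identity supporting a files-only RUNG line two levels below W2 (E1_l ⇐ (I9) ∧ `HalfLaplacianInjective l`, the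
latter OPEN in the tree); nothing here bears on `UnthreadedRigidity` (27585), the door Target, W2 or Navier–Stokes regularity; no summit statement is
proved.  0 kit.  [folklore]
-/

noncomputable section

-- the summit and its single sub-problem share the name (CONVENTIONS §1), as in every Theorems file
set_option linter.dupNamespace false

namespace Summit.NavierStokesRegularity.NavierStokesRegularity.Theorems.UnthreadedRigidity.SpectralEdge

open Set Function Filter Topology
open scoped RealInnerProductSpace ContDiff
open Literature.Analysis.FluidPDE (cross crossCLM hasFDerivAt_cross contDiff_gradient_of_contDiff_top)
open Summit.NavierStokesRegularity.NavierStokesRegularity.Theorems.UnthreadedRigidity.ProfileHorn (E3 quadY)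
open Summit.NavierStokesRegularity.NavierStokesRegularity.Theorems.UnthreadedRigidity.VirialHorn

variable {l : ℕ} {Y : E3 → ℝ}

/-! ## §1 The second directional derivative of `Φ = ⟪z × ∇Y, ∇|∇Y|²⟫` -/

/-- the angular form as an inner product: `{Y,|∇Y|²}(z) = ⟪z × ∇Y(z), ∇|∇Y|²(z)⟫`. -/
theorem angForm_eq_rotInner (Y : E3 → ℝ) :
    angForm Y = fun z : E3 => ⟪cross z (gradient Y z), gradient (fun w : E3 => ‖gradient Y w‖ ^ 2) z⟫ := by
  funext z
  unfold angForm pbr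
  rw [det3_eq_inner_cross_left]

/-- ★ `D²_v Φ(y) = ⟪2 v × Hv + y × T v v, G⟫ + 2⟪v × g + y × Hv, H_N v⟫ + ⟪y × g, T_N v v⟫` for `Φ(z) = ⟪z × ∇Y(z), ∇N(z)⟫`, `N = |∇Y|²`. [folklore] -/
theorem dir2_rotInner (hY : IsSolidHarmonic l Y) (v y : E3) :
    dir2 (fun z : E3 => ⟪cross z (gradient Y z), gradient (fun w : E3 => ‖gradient Y w‖ ^ 2) z⟫) v y =
      ⟪(2 : ℝ) • cross v (fderiv ℝ (gradient Y) y v) + cross y (fderiv ℝ (fderiv ℝ (gradient Y)) y v v),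
          gradient (fun w : E3 => ‖gradient Y w‖ ^ 2) y⟫
        + 2 * ⟪cross v (gradient Y y) + cross y (fderiv ℝ (gradient Y) y v),
            fderiv ℝ (gradient (fun w : E3 => ‖gradient Y w‖ ^ 2)) y v⟫
        + ⟪cross y (gradient Y y), fderiv ℝ (fderiv ℝ (gradient (fun w : E3 => ‖gradient Y w‖ ^ 2))) y v v⟫ := by
  -- regularity
  have hN : ContDiff ℝ ∞ (fun w : E3 => ‖gradient Y w‖ ^ 2) := contDiff_gradSq hY
  have hG : ContDiff ℝ ∞ (gradient (fun w : E3 => ‖gradient Y w‖ ^ 2)) := contDiff_gradient_of_contDiff_top hN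
  have hHN : ContDiff ℝ ∞ (fderiv ℝ (gradient (fun w : E3 => ‖gradient Y w‖ ^ 2))) := hG.fderiv_right (m := ∞) le_rfl
  have hg : ∀ z : E3, HasFDerivAt (gradient Y) (fderiv ℝ (gradient Y) z) z :=
    fun z => ((hY.contDiff_gradient.differentiable (by simp)) z).hasFDerivAt
  have hHd : ∀ z : E3, DifferentiableAt ℝ (fderiv ℝ (gradient Y)) z := fun z => (hY.contDiff_hessian.differentiable (by simp)) z
  have hGd : ∀ z : E3, HasFDerivAt (gradient (fun w : E3 => ‖gradient Y w‖ ^ 2))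
      (fderiv ℝ (gradient (fun w : E3 => ‖gradient Y w‖ ^ 2)) z) z := fun z => ((hG.differentiable (by simp)) z).hasFDerivAt
  have hHNd : ∀ z : E3, DifferentiableAt ℝ (fderiv ℝ (gradient (fun w : E3 => ‖gradient Y w‖ ^ 2))) z :=
    fun z => (hHN.differentiable (by simp)) z
  -- first derivative, at every point
  have hR : ∀ z : E3, HasFDerivAt (fun z : E3 => cross z (gradient Y z))
      (crossCLM.precompR E3 z (fderiv ℝ (gradient Y) z) + crossCLM.precompL E3 (ContinuousLinearMap.id ℝ E3) (gradient Y z)) z :=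
    fun z => hasFDerivAt_cross (hasFDerivAt_id z) (hg z)
  have hfirst : (fun z : E3 => fderiv ℝ (fun z : E3 => ⟪cross z (gradient Y z), gradient (fun w : E3 => ‖gradient Y w‖ ^ 2) z⟫) z v) =
      fun z : E3 => ⟪cross v (gradient Y z) + cross z (fderiv ℝ (gradient Y) z v), gradient (fun w : E3 => ‖gradient Y w‖ ^ 2) z⟫
        + ⟪cross z (gradient Y z), fderiv ℝ (gradient (fun w : E3 => ‖gradient Y w‖ ^ 2)) z v⟫ := by
    funext z
    rw [((hR z).inner ℝ (hGd z)).fderiv]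
    simp only [ContinuousLinearMap.comp_apply, ContinuousLinearMap.prod_apply, fderivInnerCLM_apply, _root_.add_apply,
      ContinuousLinearMap.precompR_apply, ContinuousLinearMap.compL_apply, ContinuousLinearMap.precompL_apply,
      Literature.Analysis.FluidPDE.crossCLM_apply, ContinuousLinearMap.id_apply]
    rw [add_comm (cross z (fderiv ℝ (gradient Y) z v)) (cross v (gradient Y z))]
    ring
  unfold dir2
  rw [hfirst]
  -- second derivative: the pieces
  have hHv : HasFDerivAt (fun z : E3 => fderiv ℝ (gradient Y) z v) ((fderiv ℝ (fderiv ℝ (gradient Y)) y).flip v) y := by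
    have := (hHd y).hasFDerivAt.clm_apply (hasFDerivAt_const v y)
    simpa using this
  have hHNv : HasFDerivAt (fun z : E3 => fderiv ℝ (gradient (fun w : E3 => ‖gradient Y w‖ ^ 2)) z v)
      ((fderiv ℝ (fderiv ℝ (gradient (fun w : E3 => ‖gradient Y w‖ ^ 2))) y).flip v) y := by
    have := (hHNd y).hasFDerivAt.clm_apply (hasFDerivAt_const v y)
    simpa using this
  have p1 : HasFDerivAt (fun z : E3 => cross v (gradient Y z))
      (crossCLM.precompR E3 v (fderiv ℝ (gradient Y) y) + crossCLM.precompL E3 (0 : E3 →L[ℝ] E3) (gradient Y y)) y :=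
    hasFDerivAt_cross (hasFDerivAt_const v y) (hg y)
  have p2 : HasFDerivAt (fun z : E3 => cross z (fderiv ℝ (gradient Y) z v))
      (crossCLM.precompR E3 y ((fderiv ℝ (fderiv ℝ (gradient Y)) y).flip v)
        + crossCLM.precompL E3 (ContinuousLinearMap.id ℝ E3) (fderiv ℝ (gradient Y) y v)) y :=
    hasFDerivAt_cross (hasFDerivAt_id y) hHv
  have hA : HasFDerivAt
      (fun z : E3 => ⟪cross v (gradient Y z) + cross z (fderiv ℝ (gradient Y) z v), gradient (fun w : E3 => ‖gradient Y w‖ ^ 2) z⟫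
        + ⟪cross z (gradient Y z), fderiv ℝ (gradient (fun w : E3 => ‖gradient Y w‖ ^ 2)) z v⟫)
      ((fderivInnerCLM ℝ (cross v (gradient Y y) + cross y (fderiv ℝ (gradient Y) y v), gradient (fun w : E3 => ‖gradient Y w‖ ^ 2) y)).comp
          (((crossCLM.precompR E3 v (fderiv ℝ (gradient Y) y) + crossCLM.precompL E3 (0 : E3 →L[ℝ] E3) (gradient Y y))
            + (crossCLM.precompR E3 y ((fderiv ℝ (fderiv ℝ (gradient Y)) y).flip v)
              + crossCLM.precompL E3 (ContinuousLinearMap.id ℝ E3) (fderiv ℝ (gradient Y) y v))).prod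
            (fderiv ℝ (gradient (fun w : E3 => ‖gradient Y w‖ ^ 2)) y))
        + (fderivInnerCLM ℝ (cross y (gradient Y y), fderiv ℝ (gradient (fun w : E3 => ‖gradient Y w‖ ^ 2)) y v)).comp
          ((crossCLM.precompR E3 y (fderiv ℝ (gradient Y) y) + crossCLM.precompL E3 (ContinuousLinearMap.id ℝ E3) (gradient Y y)).prod
            ((fderiv ℝ (fderiv ℝ (gradient (fun w : E3 => ‖gradient Y w‖ ^ 2))) y).flip v))) y :=
    ((p1.add p2).inner ℝ (hGd y)).add ((hR y).inner ℝ hHNv)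
  rw [hA.fderiv]
  simp only [ContinuousLinearMap.comp_apply, ContinuousLinearMap.prod_apply, fderivInnerCLM_apply, _root_.add_apply,
    ContinuousLinearMap.precompR_apply, ContinuousLinearMap.compL_apply, ContinuousLinearMap.precompL_apply,
    Literature.Analysis.FluidPDE.crossCLM_apply, ContinuousLinearMap.id_apply, _root_.zero_apply, ContinuousLinearMap.flip_apply,
    inner_add_left]
  have h0z : ∀ w : E3, cross (0 : E3) w = 0 := fun w => by
    ext i; fin_cases i <;> simp [cross]
  simp only [h0z, two_smul, inner_add_left, inner_zero_left, add_zero]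
  ring

/-! ## §2 The cubic identity for trace-free symmetric 3-tensors -/

/-- a coordinate of a vector is its inner product with the basis vector (private copy). -/
private theorem apply_eq_inner_e' (v : E3) (i : Fin 3) : v i = ⟪v, e i⟫ := by
  rw [e, EuclideanSpace.inner_single_right]; simp

/-- the inner product in coordinates (private copy). -/
private theorem real_inner_e3' (u v : E3) : ⟪u, v⟫ = u 0 * v 0 + u 1 * v 1 + u 2 * v 2 := by
  simp [PiLp.inner_apply, Fin.sum_univ_three, mul_comm]

/-- a component of the cross product (private copy). -/
private theorem cross_apply_zero' (u v : E3) : cross u v 0 = u 1 * v 2 - u 2 * v 1 := by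
  simp [cross, cross_apply]

/-- a component of the cross product (private copy). -/
private theorem cross_apply_one' (u v : E3) : cross u v 1 = u 2 * v 0 - u 0 * v 2 := by
  simp [cross, cross_apply]

/-- a component of the cross product (private copy). -/
private theorem cross_apply_two' (u v : E3) : cross u v 2 = u 0 * v 1 - u 1 * v 0 := by
  simp [cross, cross_apply]

/-- expansion of `T u (eᵢ)` in the coordinates of `u`. -/
theorem clm2_apply_e_expand (T : E3 →L[ℝ] E3 →L[ℝ] E3) (u : E3) (i : Fin 3) :
    T u (e i) = ∑ p : Fin 3, u p • T (e p) (e i) := by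
  conv_lhs => rw [eq_sum_smul_e u]
  rw [map_sum, FunLike.coe_sum, Finset.sum_apply]
  refine Finset.sum_congr rfl fun p _ => ?_
  rw [map_smul, FunLike.coe_smul, Pi.smul_apply]

/-- expansion of `T (eᵢ) u` in the coordinates of `u`. -/
theorem clm2_e_apply_expand (T : E3 →L[ℝ] E3 →L[ℝ] E3) (u : E3) (i : Fin 3) :
    T (e i) u = ∑ q : Fin 3, u q • T (e i) (e q) := by
  conv_lhs => rw [eq_sum_smul_e u]
  rw [map_sum]
  refine Finset.sum_congr rfl fun q _ => ?_
  rw [map_smul]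

/-- ★ THE CUBIC IDENTITY: for a symmetric trace-free bilinear operator `T : ℝ³ → ℝ³ → ℝ³` (symmetric in its arguments and as a map, all
traces zero) and `H = c·T(y)`: `Σᵢ ⟪y × Heᵢ, T eᵢ a⟫ = Σᵢ ⟪T(y × a) eᵢ, H eᵢ⟫` for all `a` (a polynomial identity in the seven free components
of `T`; the ideator's lattice certificate `EDGE_certI9.py`). [folklore] -/
theorem cubic_identity (T : E3 →L[ℝ] E3 →L[ℝ] E3) (hT1 : ∀ u w : E3, T u w = T w u)
    (hT2 : ∀ u w x : E3, ⟪T u w, x⟫ = ⟪T u x, w⟫) (htr : ∀ w : E3, ∑ i : Fin 3, ⟪T w (e i), e i⟫ = 0)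
    {H : E3 →L[ℝ] E3} {c : ℝ} (y : E3) (hH : ∀ w : E3, H w = c • T y w) (a : E3) :
    ∑ i : Fin 3, ⟪cross y (H (e i)), T (e i) a⟫ = ∑ i : Fin 3, ⟪T (cross y a) (e i), H (e i)⟫ := by
  -- the two generators of the symmetry group on the atoms `T (e p) (e q) k`
  have s12 : ∀ p q : Fin 3, ∀ k : Fin 3, T (e p) (e q) k = T (e q) (e p) k := fun p q k => by rw [hT1]
  have s23 : ∀ p q : Fin 3, ∀ k : Fin 3, T (e p) (e q) k = T (e p) (e k) q := fun p q k => by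
    rw [apply_eq_inner_e' (T (e p) (e q)) k, apply_eq_inner_e' (T (e p) (e k)) q, hT2]
  -- canonical forms of the 17 non-sorted atoms
  have c010 : T (e 0) (e 1) 0 = T (e 0) (e 0) 1 := by rw [s23 0 1 0]
  have c020 : T (e 0) (e 2) 0 = T (e 0) (e 0) 2 := by rw [s23 0 2 0]
  have c021 : T (e 0) (e 2) 1 = T (e 0) (e 1) 2 := by rw [s23 0 2 1]
  have c100 : T (e 1) (e 0) 0 = T (e 0) (e 0) 1 := by rw [s12 1 0 0, s23 0 1 0]
  have c101 : T (e 1) (e 0) 1 = T (e 0) (e 1) 1 := by rw [s12 1 0 1]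
  have c102 : T (e 1) (e 0) 2 = T (e 0) (e 1) 2 := by rw [s12 1 0 2]
  have c110 : T (e 1) (e 1) 0 = T (e 0) (e 1) 1 := by rw [s23 1 1 0, s12 1 0 1]
  have c120 : T (e 1) (e 2) 0 = T (e 0) (e 1) 2 := by rw [s23 1 2 0, s12 1 0 2]
  have c121 : T (e 1) (e 2) 1 = T (e 1) (e 1) 2 := by rw [s23 1 2 1]
  have c200 : T (e 2) (e 0) 0 = T (e 0) (e 0) 2 := by rw [s12 2 0 0, s23 0 2 0]
  have c201 : T (e 2) (e 0) 1 = T (e 0) (e 1) 2 := by rw [s12 2 0 1, s23 0 2 1]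
  have c202 : T (e 2) (e 0) 2 = T (e 0) (e 2) 2 := by rw [s12 2 0 2]
  have c210 : T (e 2) (e 1) 0 = T (e 0) (e 1) 2 := by rw [s12 2 1 0, s23 1 2 0, s12 1 0 2]
  have c211 : T (e 2) (e 1) 1 = T (e 1) (e 1) 2 := by rw [s12 2 1 1, s23 1 2 1]
  have c212 : T (e 2) (e 1) 2 = T (e 1) (e 2) 2 := by rw [s12 2 1 2]
  have c220 : T (e 2) (e 2) 0 = T (e 0) (e 2) 2 := by rw [s23 2 2 0, s12 2 0 2]
  have c221 : T (e 2) (e 2) 1 = T (e 1) (e 2) 2 := by rw [s23 2 2 1, s12 2 1 2]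
  -- the three trace relations, solved for the atoms `(0,2,2)`, `(1,2,2)`, `(2,2,2)`
  have htr' : ∀ p : Fin 3, T (e p) (e 0) 0 + T (e p) (e 1) 1 + T (e p) (e 2) 2 = 0 := by
    intro p
    have h := htr (e p)
    rw [Fin.sum_univ_three, ← apply_eq_inner_e', ← apply_eq_inner_e', ← apply_eq_inner_e'] at h
    exact h
  have ht0 : T (e 0) (e 2) 2 = -T (e 0) (e 0) 0 - T (e 0) (e 1) 1 := by
    have h := htr' 0; linarith
  have ht1 : T (e 1) (e 2) 2 = -T (e 0) (e 0) 1 - T (e 1) (e 1) 1 := by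
    have h := htr' 1; rw [c100] at h; linarith
  have ht2 : T (e 2) (e 2) 2 = -T (e 0) (e 0) 2 - T (e 1) (e 1) 2 := by
    have h := htr' 2; rw [c200, c211] at h; linarith
  -- expand everything in coordinates
  simp only [hH, clm2_apply_e_expand T y, clm2_apply_e_expand T (cross y a), clm2_e_apply_expand T a, Fin.sum_univ_three,
    real_inner_e3', cross_apply_zero', cross_apply_one', cross_apply_two', PiLp.add_apply, PiLp.smul_apply, smul_eq_mul]
  simp only [c010, c020, c021, c100, c101, c102, c110, c120, c121, c200, c201, c202, c210, c211, c212, c220, c221]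
  rw [ht0, ht1, ht2]
  ring

/-! ## §3 ★ (I9) `BracketLaplacian l`, VERBATIM, every degree -/

/-- ★ **(I9) — the sketch's `BracketLaplacian l` VERBATIM** (sketch-local `hessSq` unfolded), for every degree `l`: for a solid harmonic `Y` of
degree `l`, `Δ₃{Y,|∇Y|²} = 4·{Y, |∇²Y|²}` at every point of `ℝ³` (module docstring for the proof). -/
theorem bracketLaplacian (l : ℕ) :
    ∀ Y : E3 → ℝ, IsSolidHarmonic l Y → ∀ y : E3,
      lap3 (angForm Y) y = 4 * pbr Y (fun z : E3 => ∑ i : Fin 3, ‖fderiv ℝ (gradient Y) z (e i)‖ ^ 2) y := by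
  intro Y hY y
  have hN2 : ContDiff ℝ 2 (fun w : E3 => ‖gradient Y w‖ ^ 2) := (contDiff_gradSq hY).of_le (by norm_cast)
  -- abbreviations by equations (no `set`, to keep the jet lemmas applicable)
  rw [angForm_eq_rotInner Y]
  unfold lap3
  simp only [dir2_rotInner hY]
  rw [Finset.sum_add_distrib, Finset.sum_add_distrib]
  -- (1) `Σᵢ ⟪2 eᵢ × Heᵢ + y × Teᵢeᵢ, G⟫ = 0`
  have h1 : ∑ i : Fin 3, ⟪(2 : ℝ) • cross (e i) (fderiv ℝ (gradient Y) y (e i)) + cross y (fderiv ℝ (fderiv ℝ (gradient Y)) y (e i) (e i)),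
      gradient (fun w : E3 => ‖gradient Y w‖ ^ 2) y⟫ = 0 := by
    have hs : ∀ i : Fin 3, ⟪(2 : ℝ) • cross (e i) (fderiv ℝ (gradient Y) y (e i)) + cross y (fderiv ℝ (fderiv ℝ (gradient Y)) y (e i) (e i)),
        gradient (fun w : E3 => ‖gradient Y w‖ ^ 2) y⟫ =
        2 * ⟪cross (e i) (fderiv ℝ (gradient Y) y (e i)), gradient (fun w : E3 => ‖gradient Y w‖ ^ 2) y⟫
          + ⟪crossCLM y (fderiv ℝ (fderiv ℝ (gradient Y)) y (e i) (e i)), gradient (fun w : E3 => ‖gradient Y w‖ ^ 2) y⟫ := by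
      intro i
      rw [inner_add_left, inner_smul_left, Literature.Analysis.FluidPDE.crossCLM_apply]
      simp only [conj_trivial]
    simp only [hs, Finset.sum_add_distrib, ← Finset.mul_sum, ← sum_inner, ← map_sum, sum_third_self hY y, map_zero, inner_zero_left,
      add_zero, sum_inner_cross_e_apply_left_eq_zero (fderiv ℝ (gradient Y) y) (hY.hessian_symm y), mul_zero]
  -- (2) `Σᵢ 2⟪eᵢ × g + y × Heᵢ, H_N eᵢ⟫ = 4Σᵢ⟪y × Heᵢ, Teᵢ g⟫`
  have hHNsymm : ∀ u w : E3, ⟪fderiv ℝ (gradient (fun w : E3 => ‖gradient Y w‖ ^ 2)) y u, w⟫ =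
      ⟪u, fderiv ℝ (gradient (fun w : E3 => ‖gradient Y w‖ ^ 2)) y w⟫ := fun u w => inner_fderiv_gradient_symm hN2 y u w
  have h2 : ∑ i : Fin 3, 2 * ⟪cross (e i) (gradient Y y) + cross y (fderiv ℝ (gradient Y) y (e i)),
        fderiv ℝ (gradient (fun w : E3 => ‖gradient Y w‖ ^ 2)) y (e i)⟫ =
      4 * ∑ i : Fin 3, ⟪cross y (fderiv ℝ (gradient Y) y (e i)), fderiv ℝ (fderiv ℝ (gradient Y)) y (e i) (gradient Y y)⟫ := by
    have hs : ∀ i : Fin 3, 2 * ⟪cross (e i) (gradient Y y) + cross y (fderiv ℝ (gradient Y) y (e i)),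
        fderiv ℝ (gradient (fun w : E3 => ‖gradient Y w‖ ^ 2)) y (e i)⟫ =
        2 * ⟪cross (e i) (gradient Y y), fderiv ℝ (gradient (fun w : E3 => ‖gradient Y w‖ ^ 2)) y (e i)⟫
        + 4 * ⟪cross y (fderiv ℝ (gradient Y) y (e i)), fderiv ℝ (gradient Y) y (fderiv ℝ (gradient Y) y (e i))⟫
        + 4 * ⟪cross y (fderiv ℝ (gradient Y) y (e i)), fderiv ℝ (fderiv ℝ (gradient Y)) y (e i) (gradient Y y)⟫ := by
      intro i
      rw [inner_add_left]
      conv_lhs => rw [fderiv_gradient_gradSq_apply hY y (e i)]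
      rw [fderiv_gradient_gradSq_apply hY y (e i), inner_smul_right, inner_add_right, inner_smul_right, inner_add_right]
      ring
    simp only [hs, Finset.sum_add_distrib, ← Finset.mul_sum,
      sum_inner_cross_e_apply_eq_zero (fderiv ℝ (gradient (fun w : E3 => ‖gradient Y w‖ ^ 2)) y) hHNsymm (gradient Y y),
      sum_inner_cross_apply_sq_eq_zero (fderiv ℝ (gradient Y) y) (hY.hessian_symm y) y, mul_zero, zero_add]
  -- (3) `Σᵢ ⟪y × g, T_N eᵢ eᵢ⟫ = 2⟪y × g, ∇|H|²⟫`
  have h3 : ∑ i : Fin 3, ⟪cross y (gradient Y y), fderiv ℝ (fderiv ℝ (gradient (fun w : E3 => ‖gradient Y w‖ ^ 2))) y (e i) (e i)⟫ =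
      2 * ⟪cross y (gradient Y y), gradient (fun z : E3 => ∑ i : Fin 3, ‖fderiv ℝ (gradient Y) z (e i)‖ ^ 2) y⟫ := by
    rw [← inner_sum, sum_third_gradSq hY y, inner_smul_right]
  rw [h1, h2, h3, zero_add]
  -- the right-hand side `4 {Y, |H|²} = 4 ⟪y × g, ∇|H|²⟫ = 8 Σᵢ ⟪T (y × g) eᵢ, H eᵢ⟫`
  unfold pbr
  rw [det3_eq_inner_cross_left, real_inner_comm (gradient _ y) (cross y (gradient Y y)) , inner_gradient_hessSq hY]
  -- the cubic identity: `l = 2` (then `T = 0`) or `H = (l−2)⁻¹ T(y)`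
  rcases eq_or_ne l 2 with hl2 | hl2
  · -- degree two: the third jet vanishes
    subst hl2
    have hY' := hY
    obtain ⟨⟨P, hPh, hPe⟩, -⟩ := hY'
    obtain ⟨Q, hQs, hQe⟩ := exists_quadY_of_isHomogeneous_two P hPh
    have hYQ : Y = quadY Q := funext fun z => (hPe z).trans (hQe z)
    obtain ⟨G, hG⟩ := exists_hessOp Q
    have hT0 : fderiv ℝ (fderiv ℝ (gradient Y)) y = 0 := by
      have hH : fderiv ℝ (gradient Y) = fun _ => G := by
        funext z; rw [hYQ]; exact fderiv_gradient_quadY_eq_op hQs hG z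
      rw [hH]; exact fderiv_const_apply _
    simp only [hT0, _root_.zero_apply, inner_zero_left, inner_zero_right, Finset.sum_const_zero, mul_zero, add_zero]
  · have hc : ((l : ℝ) - 2) ≠ 0 := by
      have : (l : ℝ) ≠ 2 := by exact_mod_cast hl2
      intro h; apply this; linarith
    have hH : ∀ w : E3, fderiv ℝ (gradient Y) y w = ((l : ℝ) - 2)⁻¹ • fderiv ℝ (fderiv ℝ (gradient Y)) y y w := by
      intro w
      rw [hY.third_apply_self y w, smul_smul, inv_mul_cancel₀ hc, one_smul]
    rw [cubic_identity (fderiv ℝ (fderiv ℝ (gradient Y)) y) (hY.third_symm y) (hY.third_symm' y) (hY.trace_third y) y hH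
      (gradient Y y)]
    ring

/-! ## §4 ★ The half-Laplacian form of the edge coefficient: `EdgeHalfLaplacian l`, VERBATIM, every degree -/

/-- ★ **the sketch's `EdgeHalfLaplacian l` VERBATIM** (sketch-local `edgeForm` / `hessSq` / `gradSq` unfolded), for every degree `l`:
`48𝔅_l[Y] = ½Δ₃{Y,|∇Y|²} + (12l − 2)·{Y,|∇Y|²}` at every point — the sketch's kernel-checked glue `edgeHalfLaplacian_of_bracket` with its
hypothesis `BracketLaplacian l` discharged by `bracketLaplacian l` (`−(4l²−20l+6) + 4(l−1)² = 12l − 2`). -/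
theorem edgeHalfLaplacian (l : ℕ) :
    ∀ Y : E3 → ℝ, IsSolidHarmonic l Y → ∀ y : E3,
      lap3 (angForm Y) y - (4 * (l : ℝ) ^ 2 - 20 * (l : ℝ) + 6) * angForm Y y
          - 2 * pbr Y (fun z => (∑ i : Fin 3, ‖fderiv ℝ (gradient Y) z (e i)‖ ^ 2) - 2 * ((l : ℝ) - 1) ^ 2 * ‖gradient Y z‖ ^ 2) y
        = (1 / 2) * lap3 (angForm Y) y + (12 * (l : ℝ) - 2) * angForm Y y := by
  intro Y hY y
  have hB := bracketLaplacian l Y hY y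
  have hGn : Differentiable ℝ (fun z : E3 => ‖gradient Y z‖ ^ 2) := (hY.contDiff_gradient.differentiable (by simp)).norm_sq ℝ
  have hHs : DifferentiableAt ℝ (fun z : E3 => ∑ i : Fin 3, ‖fderiv ℝ (gradient Y) z (e i)‖ ^ 2) y :=
    (hasFDerivAt_hessSq hY y).differentiableAt
  rw [pbr_sub Y hHs ((hGn y).const_mul _), pbr_const_mul Y _ (hGn y)]
  have hA : pbr Y (fun z : E3 => ‖gradient Y z‖ ^ 2) y = angForm Y y := rfl
  rw [hA]
  linear_combination (1 / 2 : ℝ) * hB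

end Summit.NavierStokesRegularity.NavierStokesRegularity.Theorems.UnthreadedRigidity.SpectralEdge

end
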